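import Summits.BirchSwinnertonDyer.BirchSwinnertonDyer.Theses.TangentCone
import Literature.Barriers.BirchSwinnertonDyer.DescentDefectUnboundedKramerHoldsProofs

/-!
# BirchSwinnertonDyer — crux `SelmerRankShaPFinite` (stmt-BirchSwinnertonDyer-0132):
# negative lemmas — two natural strengthenings are FALSE (standing disprover, cycle 1)

The crux (`Theses/TangentCone.lean`, shared verbatim by SelmerRank / ToricShedding / FrozenTwin /
VerticalContact) is
`∀ (W : WeierstrassCurve ℚ) [W.IsElliptic] (p : ℕ) [Fact p.Prime], Finite ↥(AddCommGroup.primaryComponent ↥W.sha p)`,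
the `p`-primary Tate–Shafarevich conjecture over `ℚ`. It is typed faithfully and is not refuted.
This file records, as kernel-checked theorems and WITHOUT asserting any route statement, that the
two obvious strengthenings a proof might aim for are false:

* `selmerRankShaPFinite_strengthening_trivial_false` — "`Ш(E/ℚ)[p^∞]` is trivial for all `E`, `p`"
  is false: Kramer's semistable curves carry `(ℤ/2)^C ↪ Ш[2] ⊆ Ш[2^∞]`;
* `selmerRankShaPFinite_strengthening_effective_false` — "`Ш(E/ℚ)[p^∞]` is finite of order
  `≤ B(p)`" is false for EVERY `B : ℕ → ℕ` (at `p = 2`: `2^{B 2} ≤ |Ш[2^∞]| ≤ B 2` is absurd), and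
  so is the uniform version: any proof of the crux is ineffective in `E` at a fixed prime.

Engine: the tree THEOREM `Literature.Barriers.BirchSwinnertonDyer.TwoDescentDefectUnbounded_holds`
(Kramer 1983, Theorem of §5; axioms `propext`/`Classical.choice`/`Quot.sound`) and the inclusion
`Ш[p] ↪ Ш[p^∞]` (`nRankAtLeast_shaPrimary_of_shaTorsion`). No definition is introduced.
Full adversarial record: `Cruxes/SelmerRankShaPFinite/Disproof.lean`.
-/

set_option linter.dupNamespace false

noncomputable section

open scoped Classical

namespace Summit.BirchSwinnertonDyer.BirchSwinnertonDyer.Theorems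

open Literature.Barriers.BirchSwinnertonDyer
open WeierstrassCurve

/-- An element killed by a prime `p` lies in the `p`-primary component (its order is `1` or `p`).
[folklore] -/
theorem selmerRankShaPFinite_mem_primaryComponent_of_prime_nsmul {G : Type*} [AddCommGroup G]
    (p : ℕ) [hp : Fact p.Prime] {y : G} (hy : p • y = 0) :
    y ∈ AddCommGroup.primaryComponent G p := by
  rw [AddCommGroup.mem_primaryComponent_iff_addOrderOf]
  rcases (Nat.dvd_prime hp.out).mp (addOrderOf_dvd_of_nsmul_eq_zero hy) with h | h
  · exact ⟨0, by rw [h, pow_zero]⟩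
  · exact ⟨1, by rw [h, pow_one]⟩

/-- **`Ш(E/ℚ)[p] ↪ Ш(E/ℚ)[p^∞]`** at the level of `rk_p`: a copy of `(ℤ/p)^k` in the `p`-torsion
of Ш (tree spelling `shaTorsion W p = W.sha ⊓ H¹(ℚ,E)[p]`) gives one in the `p`-primary component
of Ш (the inclusion of underlying classes is an injective homomorphism). [folklore] -/
theorem nRankAtLeast_shaPrimary_of_shaTorsion (W : WeierstrassCurve ℚ) (p : ℕ) [Fact p.Prime]
    {k : ℕ} (hk : nRankAtLeast ↥(shaTorsion W (p : ℤ)) p k) :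
    nRankAtLeast ↥(AddCommGroup.primaryComponent (↥W.sha) p) p k := by
  let ι : ↥(shaTorsion W (p : ℤ)) →+ ↥(AddCommGroup.primaryComponent (↥W.sha) p) :=
    { toFun := fun x => ⟨⟨(x : W.galH1), (AddSubgroup.mem_inf.mp x.2).1⟩,
        selmerRankShaPFinite_mem_primaryComponent_of_prime_nsmul p (by
          apply Subtype.ext
          have hx : ((p : ℤ)) • (x : W.galH1) = 0 := (AddSubgroup.mem_inf.mp x.2).2
          rw [natCast_zsmul] at hx
          simpa using hx)⟩
      map_zero' := rfl
      map_add' := fun _ _ => rfl }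
  refine hk.of_injective ι fun x y h => ?_
  have := congrArg
    (fun z : ↥(AddCommGroup.primaryComponent (↥W.sha) p) => ((z : ↥W.sha) : W.galH1)) h
  exact Subtype.ext this

/-- Kramer's theorem transported to the `2`-primary component: for every `C` a semistable elliptic
`E/ℚ` with `(ℤ/2)^C ↪ Ш(E/ℚ)[2^∞]`. [cite: Kramer1983, Theorem (§5)] -/
theorem selmerRankShaPFinite_exists_twoRank_shaPrimary_ge (C : ℕ) :
    ∃ W : WeierstrassCurve ℚ, W.IsElliptic ∧ W.IsSemistable ℤ ∧
      nRankAtLeast ↥(AddCommGroup.primaryComponent (↥W.sha) 2) 2 C := by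
  haveI : Fact (Nat.Prime 2) := ⟨Nat.prime_two⟩
  obtain ⟨W, hW, hss, hrk⟩ := TwoDescentDefectUnbounded_holds C
  exact ⟨W, hW, hss, nRankAtLeast_shaPrimary_of_shaTorsion W 2 hrk⟩

/-- **Strengthening 1 of `SelmerRankShaPFinite` is false**: it is NOT the case that `Ш(E/ℚ)[p^∞]`
is trivial for every elliptic `E/ℚ` and every prime `p` (Kramer's semistable curve at `p = 2`).
So the crux cannot be proved by a vanishing statement. [cite: Kramer1983, Theorem (§5)] -/
theorem selmerRankShaPFinite_strengthening_trivial_false :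
    ¬ ∀ (W : WeierstrassCurve ℚ) [W.IsElliptic] (p : ℕ) [Fact p.Prime],
        Subsingleton ↥(AddCommGroup.primaryComponent (↥W.sha) p) := by
  intro h
  haveI : Fact (Nat.Prime 2) := ⟨Nat.prime_two⟩
  obtain ⟨W, hW, -, f, hf⟩ := selmerRankShaPFinite_exists_twoRank_shaPrimary_ge 1
  haveI := hW
  haveI := h W 2
  have h01 : (fun _ => 1 : Fin 1 → ZMod 2) = 0 := hf (Subsingleton.elim _ _)
  exact one_ne_zero (congrFun h01 0)

/-- **Strengthening 2 of `SelmerRankShaPFinite` (the effective crux) is false**: there is no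
`B : ℕ → ℕ` with `Ш(E/ℚ)[p^∞]` finite of order `≤ B p` for all elliptic `E/ℚ` and primes `p`
— already at `p = 2` over semistable curves, `2^{B 2} ≤ |Ш[2^∞]|`. Any proof of the crux is
ineffective in `E` at a fixed prime. [cite: Kramer1983, Theorem (§5)] -/
theorem selmerRankShaPFinite_strengthening_effective_false :
    ¬ ∃ B : ℕ → ℕ, ∀ (W : WeierstrassCurve ℚ) [W.IsElliptic] (p : ℕ) [Fact p.Prime],
        Finite ↥(AddCommGroup.primaryComponent (↥W.sha) p) ∧
          Nat.card ↥(AddCommGroup.primaryComponent (↥W.sha) p) ≤ B p := by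
  rintro ⟨B, hB⟩
  haveI : Fact (Nat.Prime 2) := ⟨Nat.prime_two⟩
  obtain ⟨W, hW, -, hrk⟩ := selmerRankShaPFinite_exists_twoRank_shaPrimary_ge (B 2)
  haveI := hW
  obtain ⟨hfin, hcard⟩ := hB W 2
  have hpow : 2 ^ B 2 ≤ Nat.card ↥(AddCommGroup.primaryComponent (↥W.sha) 2) := hrk.pow_le_card
  exact absurd (hpow.trans hcard) (not_le.mpr (B 2).lt_two_pow_self)

/-- The uniform version (one bound for all curves and primes) is a fortiori false.
[cite: Kramer1983, Theorem (§5)] -/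
theorem selmerRankShaPFinite_strengthening_uniform_false :
    ¬ ∃ B : ℕ, ∀ (W : WeierstrassCurve ℚ) [W.IsElliptic] (p : ℕ) [Fact p.Prime],
        Finite ↥(AddCommGroup.primaryComponent (↥W.sha) p) ∧
          Nat.card ↥(AddCommGroup.primaryComponent (↥W.sha) p) ≤ B := by
  rintro ⟨B, hB⟩
  exact selmerRankShaPFinite_strengthening_effective_false ⟨fun _ => B, fun W _ p _ => hB W p⟩

end Summit.BirchSwinnertonDyer.BirchSwinnertonDyer.Theorems

end
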